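import Literature.MathematicalPhysics.QuantumFieldTheory.Balaban1983to89.B3Eq327Cxi

/-!
# `Balaban1983to89.B3Eq338Middle` — T. Bałaban, *(Higgs)₂,₃ quantum fields in a finite volume. III. Renormalization*,
Commun. Math. Phys. **88** (1983) 411–445 [Balaban1983Higgs3], p. 444 [PDF 34]: the printed MIDDLE member of **(3.38)**,
typed with body, and the printed chain of (3.38) for the free propagator C^ξ PROVED member by member (ξ > 0)

statement-level skeleton of published theorems with citation tags; proofs where landed; nothing here is a claim about the Yang–Mills mass gap

PDF held: `paper:balaban1983-higgs-2-3-quantum-fields-finite-volume` (journal page = PDF page + 410).  The display was read on the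
page render `run/shared/lean/pub/pub-balaban/b2b-balaban-ref1/pages/1983-cmp88-higgs23-III/1983-cmp88-higgs23-III-p034-x4.png`
(the OCR of PDF p. 34 is illegible at the display; the render is not).

CITATION HEADER (lean-in-tree rule).  Part of the lit-balaban TYPED SKELETON (HOME `run/shared/lean/pub/lit-balaban/`), reader/typer
seat r15 (fold owner of B3), generation 4.  Row **B3.Eq3.33-3.38** of `HOME/lit-balaban-r15/ROWS-B3.md`: the companion
`B3Sect3TriangleGraphs` (r15 g3) types the FIRST member of (3.38) (`lhs338`), its LAST member (`last338`, with the lattice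
convolution `convZ`) and proves the last member's vanishing (`last338_eq_zero`) and types the chain first = last as `Eq338`;
seat p03 g2's `B3Eq324Parseval.eq338_holds` PROVES `Eq338 d ξ q3` for ξ > 0 (convolution theorem on T^d).  What was left
(ROWS cell «NOT yet: … the printed middle member of (3.38)») is done here.

THE PRINTED TEXT (verbatim, p. 444 [PDF 34], page render).  *"Finally for the graphs (2.20) it equals
−q³ Σ_{y,y″} ξ^{2d} Σ_{ν=1}^d [(∂^ξ_νC^ξ)(y′−y)(∂^ξ_μC^ξ∂^{ξ*}_ν)(y−y″)C^ξ(y′−y″) − (∂^ξ_νC^ξ∂^{ξ*}_μ)(y′−y)(C^ξ∂^{ξ*}_ν)(y−y″)C^ξ(y′−y″)]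
= −q³ Σ_{y,y″} ξ^{2d}(−Δ^ξC^ξ)(y″)C^ξ(y″−y)((∂^ξ_μC^ξ)(y) − (∂^{ξ*}_μC^ξ)(y))
= −q³ Σ_y ξ^d C^ξ(y)(C^ξ(y+ξe_μ) − C^ξ(y−ξe_μ))/ξ + q³ Σ_y ξ^d(C^ξ∗C^ξ)(y)(C^ξ(y+ξe_μ) − C^ξ(y−ξe_μ))/ξ = 0, (3.38)
because the functions which we are summing are odd."*

WHAT IS TYPED / PROVED.  `mid338Of ξ q3 C μ` — the second (middle) member for a kernel C on ξℤ^d, with −Δ^ξ = r15 g4's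
`B3CxiPropagator.negLapZ` (Σ_{y,y″} as an iterated `tsum`, y outer; the member no longer involves the external point y′);
`mid338 d ξ q3 μ` — at C = C^ξ (`Cxi`).  PROVED, for ξ > 0: **`mid338_eq_last338`** — middle member = last member, EXACTLY the
printed reduction: (−Δ^ξC^ξ)(y″) = ξ^{−d}1_{y″=0} − C^ξ(y″) ((3.16) "−Δ^ξC^ξ = δ^ξ − C^ξ", `B3CxiPropagator.negLapZ_Cxi_add`), the
δ-term producing −q³Σ_yξ^dC^ξ(y)(…)/ξ (C^ξ even) and the C^ξ-term the convolution term +q³Σ_yξ^d(C^ξ∗C^ξ)(y)(…)/ξ, with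
(∂^ξ_μC)(y) − (∂^{ξ*}_μC)(y) = (C(y+ξe_μ) − C(y−ξe_μ))/ξ; every lattice sum converges absolutely (`B3Eq327Cxi.summable_abs_Cxi`,
`B3CxiPropagator.abs_Cxi_le`).  **`lhs338_eq_mid338`** — first member = middle member for C^ξ, obtained from p03's
`eq338_holds` (first = last) and `mid338_eq_last338`; the printed direct route first → middle (summation by parts in y and
Σ_ν∂^ξ_ν∂^{ξ*}_ν = −Δ^ξ) is NOT replayed here (T1).  `mid338_eq_zero` — hence the middle member vanishes too.  NOTHING beyond the
kernel-checked statements below is asserted.  Unit `lit-balaban-r15` (literature-prover-lit-balaban-r15-g4-0), 2026-08-21.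

v1.1 (append-only, r15 gen 5, 2026-08-21): **the printed DIRECT route first member → middle member of (3.38) REPLAYED**
(what v1's T1 left out): for EVERY even kernel C on ξℤ^d with Σ_z|C(z)| < ∞, `lhs338_eq_mid338Of` — summation by parts in y
(∂^ξ_ν, ∂^{ξ*}_μ moved across the lattice correlation Σ_wC(w)g(w − u), kernel lemmas `tsum_pdiffZ_mul`/`tsum_pdiffAdjZ_mul`/
`corrZ_pdiffZ`/`corrZ_pdiffAdjZ`) and Σ_ν∂^ξ_ν∂^{ξ*}_ν = Σ_ν∂^{ξ*}_ν∂^ξ_ν = −Δ^ξ (`B3CxiPropagator.sum_pdiffZ_pdiffAdjZ`); both members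
equal −q³ξ^{2d}Σ_u[(∂^ξ_μC)(u) − (∂^{ξ*}_μC)(u)](−Δ^ξP)(u), P(u) = Σ_wC(w)C(w − u); every lattice sum converges absolutely
(ℓ¹ × ℓ^∞ products, no interchange of summations is needed).  For C^ξ: `lhs338_eq_mid338_direct` and `eq338_direct` — a second,
independent proof of `B3Sect3TriangleGraphs.Eq338 d ξ q3` along the printed route (v1 used p03's Parseval route for this step).
-/

namespace Literature.MathematicalPhysics.QuantumFieldTheory.Balaban1983to89.B3Eq338Middle

open B3Sect3VectorSelfEnergy B3Sect3TriangleGraphs B3CxiPropagator B3Eq327Cxi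

variable {d : ℕ}

/-- The MIDDLE member of **(3.38)** p. 444 [PDF 34], verbatim (page render): *"= −q³ Σ_{y,y″} ξ^{2d}(−Δ^ξC^ξ)(y″)C^ξ(y″−y)
((∂^ξ_μC^ξ)(y) − (∂^{ξ*}_μC^ξ)(y))"* — for a kernel C on ξℤ^d (−Δ^ξ = `B3CxiPropagator.negLapZ`; Σ_{y,y″} as an iterated
lattice sum, y outer, as in `lhs338`). [cite: Balaban1983Higgs3, (3.38) p.444] -/
noncomputable def mid338Of (ξ q3 : ℝ) (C : ZSite d → ℝ) (μ : Fin d) : ℝ :=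
  -q3 * ∑' y : ZSite d, ∑' y'' : ZSite d, ξ ^ (2 * d) *
    (negLapZ ξ C y'' * C (y'' - y) * (pdiffZ ξ⁻¹ μ C y - pdiffAdjZ ξ⁻¹ μ C y))

/-- The middle member of **(3.38)** for the free propagator C^ξ = (−Δ^ξ + 1)^{−1} itself (`Cxi`).
[cite: Balaban1983Higgs3, (3.38) p.444] -/
noncomputable def mid338 (d : ℕ) (ξ q3 : ℝ) (μ : Fin d) : ℝ :=
  mid338Of ξ q3 (Cxi d ξ) μ

/-- kernel: `mid338` is `mid338Of` at C = C^ξ. [cite: Balaban1983Higgs3, (3.38) p.444] -/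
theorem mid338_eq_of (ξ q3 : ℝ) (μ : Fin d) : mid338 d ξ q3 μ = mid338Of ξ q3 (Cxi d ξ) μ := rfl

section Reduction

variable {ξ : ℝ}

/-- kernel: (∂^ξ_μC)(y) − (∂^{ξ*}_μC)(y) = (C(y+ξe_μ) − C(y−ξe_μ))/ξ. [cite: Balaban1983Higgs3, (3.38) p.444] -/
theorem pdiffZ_sub_pdiffAdjZ (ξ : ℝ) (μ : Fin d) (C : ZSite d → ℝ) (y : ZSite d) :
    pdiffZ ξ⁻¹ μ C y - pdiffAdjZ ξ⁻¹ μ C y = (C (y + unitVec μ) - C (y - unitVec μ)) / ξ := by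
  simp only [pdiffZ, pdiffAdjZ]
  rw [div_eq_inv_mul]
  ring

/-- kernel: (3.16) solved for −Δ^ξC^ξ: (−Δ^ξC^ξ)(y) = ξ^{−d}1_{y=0} − C^ξ(y). [cite: Balaban1983Higgs3, (3.16) p.437] -/
theorem negLapZ_Cxi_eq (hξ : 0 < ξ) (y : ZSite d) :
    negLapZ ξ (Cxi d ξ) y = (if y = 0 then ξ⁻¹ ^ d else 0) - Cxi d ξ y :=
  eq_sub_of_add_eq (negLapZ_Cxi_add hξ y)

/-- kernel: the C^ξ-summands of the inner y″-sum are absolutely summable (C^ξ bounded by ξ^{−d}, Σ|C^ξ| < ∞). [folklore] -/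
private theorem summable_Cxi_mul_translate (hξ : 0 < ξ) (y : ZSite d) (a : ℝ) :
    Summable fun y'' : ZSite d => a * (Cxi d ξ y'' * Cxi d ξ (y'' - y)) := by
  refine (Summable.of_norm_bounded ((summable_abs_Cxi (d := d) hξ).mul_left (ξ⁻¹ ^ d)) fun y'' => ?_).mul_left a
  rw [Real.norm_eq_abs, abs_mul, mul_comm]
  exact mul_le_mul_of_nonneg_right (abs_Cxi_le hξ _) (abs_nonneg _)

/-- kernel: the inner y″-sum of the middle member for C^ξ — the δ-part of −Δ^ξC^ξ picks y″ = 0, the C^ξ-part is the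
lattice convolution: Σ_{y″}ξ^{2d}(−Δ^ξC^ξ)(y″)C^ξ(y″−y)·D = ξ^dC^ξ(y)·D − ξ^d(C^ξ∗C^ξ)(y)·D. [cite: Balaban1983Higgs3, (3.38) p.444] -/
theorem inner338_Cxi (hξ : 0 < ξ) (y : ZSite d) (D : ℝ) :
    ∑' y'' : ZSite d, ξ ^ (2 * d) * (negLapZ ξ (Cxi d ξ) y'' * Cxi d ξ (y'' - y) * D) =
      ξ ^ d * Cxi d ξ y * D - ξ ^ d * convZ ξ (Cxi d ξ) y * D := by
  have hξ0 : ξ ≠ 0 := hξ.ne'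
  -- split the summand along −Δ^ξC^ξ = δ^ξ − C^ξ
  have hsplit : ∀ y'' : ZSite d, ξ ^ (2 * d) * (negLapZ ξ (Cxi d ξ) y'' * Cxi d ξ (y'' - y) * D) =
      ξ ^ (2 * d) * D * ((if y'' = 0 then ξ⁻¹ ^ d else 0) * Cxi d ξ (y'' - y)) -
        ξ ^ (2 * d) * D * (Cxi d ξ y'' * Cxi d ξ (y'' - y)) := by
    intro y''
    rw [negLapZ_Cxi_eq hξ]
    ring
  have hδs : Summable fun y'' : ZSite d =>
      ξ ^ (2 * d) * D * ((if y'' = 0 then ξ⁻¹ ^ d else 0) * Cxi d ξ (y'' - y)) := by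
    refine summable_of_ne_finset_zero (s := {0}) fun y'' hy'' => ?_
    rw [Finset.mem_singleton] at hy''
    simp [hy'']
  have hCs := summable_Cxi_mul_translate hξ y (ξ ^ (2 * d) * D)
  rw [tsum_congr hsplit, hδs.tsum_sub hCs]
  -- the δ-part
  have hδ : ∑' y'' : ZSite d, ξ ^ (2 * d) * D * ((if y'' = 0 then ξ⁻¹ ^ d else 0) * Cxi d ξ (y'' - y)) =
      ξ ^ d * Cxi d ξ y * D := by
    rw [tsum_eq_single 0 fun y'' hy'' => by simp [hy'']]
    simp only [if_true, zero_sub, Cxi_neg]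
    rw [show ξ ^ (2 * d) = ξ ^ d * ξ ^ d by rw [two_mul, pow_add], inv_pow]
    field_simp
  -- the convolution part: Σ_{y″} C(y″)C(y″−y) = Σ_z C(z)C(y−z) (C^ξ even) = ξ^{−d}(C∗C)(y)
  have hconv : ∑' y'' : ZSite d, ξ ^ (2 * d) * D * (Cxi d ξ y'' * Cxi d ξ (y'' - y)) =
      ξ ^ d * convZ ξ (Cxi d ξ) y * D := by
    have hsum : ∀ y'' : ZSite d, ξ ^ (2 * d) * D * (Cxi d ξ y'' * Cxi d ξ (y'' - y)) =
        ξ ^ d * D * (ξ ^ d * (Cxi d ξ y'' * Cxi d ξ (y - y''))) := by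
      intro y''
      rw [show y'' - y = -(y - y'') by abel, Cxi_neg, two_mul, pow_add]
      ring
    rw [tsum_congr hsum, tsum_mul_left]
    unfold convZ
    ring
  rw [hδ, hconv]

/-- kernel: the outer summands are absolutely summable — ξ^dC^ξ(y)·D(y) with D(y) = (C^ξ(y+e_μ) − C^ξ(y−e_μ))/ξ. [folklore] -/
private theorem summable_outer_C (hξ : 0 < ξ) (μ : Fin d) :
    Summable fun y : ZSite d =>
      ξ ^ d * Cxi d ξ y * (pdiffZ ξ⁻¹ μ (Cxi d ξ) y - pdiffAdjZ ξ⁻¹ μ (Cxi d ξ) y) := by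
  have h0 := summable_abs_Cxi (d := d) hξ
  have ha : Summable fun y : ZSite d => |Cxi d ξ (y + unitVec μ)| :=
    (Equiv.summable_iff (Equiv.addRight (unitVec μ))).mpr h0
  have hb : Summable fun y : ZSite d => |Cxi d ξ (y - unitVec μ)| :=
    (Equiv.summable_iff (Equiv.subRight (unitVec μ))).mpr h0
  have hg : Summable fun y : ZSite d =>
      ξ ^ d * ξ⁻¹ ^ d * (ξ⁻¹ * (|Cxi d ξ (y + unitVec μ)| + |Cxi d ξ (y - unitVec μ)|)) :=
    ((ha.add hb).mul_left ξ⁻¹).mul_left (ξ ^ d * ξ⁻¹ ^ d)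
  refine Summable.of_norm_bounded hg fun y => ?_
  rw [pdiffZ_sub_pdiffAdjZ, Real.norm_eq_abs, abs_mul, abs_mul, abs_of_pos (pow_pos hξ d), div_eq_inv_mul, abs_mul,
    abs_of_pos (inv_pos.2 hξ)]
  have h1 : |Cxi d ξ y| ≤ ξ⁻¹ ^ d := abs_Cxi_le hξ y
  have h2 : |Cxi d ξ (y + unitVec μ) - Cxi d ξ (y - unitVec μ)| ≤
      |Cxi d ξ (y + unitVec μ)| + |Cxi d ξ (y - unitVec μ)| := abs_sub _ _
  have h3 : 0 ≤ ξ⁻¹ * |Cxi d ξ (y + unitVec μ) - Cxi d ξ (y - unitVec μ)| := by positivity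
  exact mul_le_mul (mul_le_mul_of_nonneg_left h1 (pow_pos hξ d).le) (mul_le_mul_of_nonneg_left h2 (inv_pos.2 hξ).le)
    h3 (by positivity)

/-- kernel: |(C^ξ∗C^ξ)(y)| ≤ ξ^dξ^{−d}Σ_z|C^ξ(z)| — the convolution is bounded. [folklore] -/
private theorem abs_convZ_Cxi_le (hξ : 0 < ξ) (y : ZSite d) :
    |convZ ξ (Cxi d ξ) y| ≤ ξ ^ d * ξ⁻¹ ^ d * ∑' z : ZSite d, |Cxi d ξ z| := by
  unfold convZ
  have h0 := summable_abs_Cxi (d := d) hξ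
  have hs : HasSum (fun z : ZSite d => ξ ^ d * ξ⁻¹ ^ d * |Cxi d ξ z|) (ξ ^ d * ξ⁻¹ ^ d * ∑' z : ZSite d, |Cxi d ξ z|) :=
    h0.hasSum.mul_left _
  refine (Real.norm_eq_abs _).symm.trans_le (tsum_of_norm_bounded hs fun z => ?_)
  rw [Real.norm_eq_abs, abs_mul, abs_mul, abs_of_pos (pow_pos hξ d), mul_assoc]
  refine mul_le_mul_of_nonneg_left ?_ (pow_pos hξ d).le
  rw [mul_comm]
  exact mul_le_mul_of_nonneg_right (abs_Cxi_le hξ _) (abs_nonneg _)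

/-- kernel: the outer summands are absolutely summable — ξ^d(C^ξ∗C^ξ)(y)·D(y). [folklore] -/
private theorem summable_outer_conv (hξ : 0 < ξ) (μ : Fin d) :
    Summable fun y : ZSite d =>
      ξ ^ d * convZ ξ (Cxi d ξ) y * (pdiffZ ξ⁻¹ μ (Cxi d ξ) y - pdiffAdjZ ξ⁻¹ μ (Cxi d ξ) y) := by
  have h0 := summable_abs_Cxi (d := d) hξ
  set S : ℝ := ∑' z : ZSite d, |Cxi d ξ z| with hS
  have ha : Summable fun y : ZSite d => |Cxi d ξ (y + unitVec μ)| :=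
    (Equiv.summable_iff (Equiv.addRight (unitVec μ))).mpr h0
  have hb : Summable fun y : ZSite d => |Cxi d ξ (y - unitVec μ)| :=
    (Equiv.summable_iff (Equiv.subRight (unitVec μ))).mpr h0
  have hg : Summable fun y : ZSite d =>
      ξ ^ d * (ξ ^ d * ξ⁻¹ ^ d * S) * (ξ⁻¹ * (|Cxi d ξ (y + unitVec μ)| + |Cxi d ξ (y - unitVec μ)|)) :=
    ((ha.add hb).mul_left ξ⁻¹).mul_left (ξ ^ d * (ξ ^ d * ξ⁻¹ ^ d * S))
  refine Summable.of_norm_bounded hg fun y => ?_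
  rw [pdiffZ_sub_pdiffAdjZ, Real.norm_eq_abs, abs_mul, abs_mul, abs_of_pos (pow_pos hξ d), div_eq_inv_mul, abs_mul,
    abs_of_pos (inv_pos.2 hξ)]
  have h1 : |convZ ξ (Cxi d ξ) y| ≤ ξ ^ d * ξ⁻¹ ^ d * S := abs_convZ_Cxi_le hξ y
  have h2 : |Cxi d ξ (y + unitVec μ) - Cxi d ξ (y - unitVec μ)| ≤
      |Cxi d ξ (y + unitVec μ)| + |Cxi d ξ (y - unitVec μ)| := abs_sub _ _
  have h3 : 0 ≤ ξ⁻¹ * |Cxi d ξ (y + unitVec μ) - Cxi d ξ (y - unitVec μ)| := by positivity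
  have h4 : 0 ≤ ξ ^ d * ξ⁻¹ ^ d * S := le_trans (abs_nonneg _) h1
  exact mul_le_mul (mul_le_mul_of_nonneg_left h1 (pow_pos hξ d).le) (mul_le_mul_of_nonneg_left h2 (inv_pos.2 hξ).le)
    h3 (mul_nonneg (pow_pos hξ d).le h4)

/-- **(3.38)** p. 444 [PDF 34], MIDDLE member = LAST member for C^ξ (ξ > 0) — PROVED exactly as printed: reduce
(−Δ^ξC^ξ)(y″) by (3.16), "−Δ^ξC^ξ = δ^ξ − C^ξ" (`B3CxiPropagator.negLapZ_Cxi_add`): the δ-term gives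
−q³Σ_yξ^dC^ξ(y)(C^ξ(y+ξe_μ) − C^ξ(y−ξe_μ))/ξ, the C^ξ-term the convolution +q³Σ_yξ^d(C^ξ∗C^ξ)(y)(C^ξ(y+ξe_μ) − C^ξ(y−ξe_μ))/ξ
(`B3Sect3TriangleGraphs.last338`, `convZ`). [cite: Balaban1983Higgs3, (3.38) p.444] -/
theorem mid338_eq_last338 (hξ : 0 < ξ) (q3 : ℝ) (μ : Fin d) :
    mid338 d ξ q3 μ = last338 ξ q3 (Cxi d ξ) μ := by
  rw [mid338_eq_of, mid338Of, last338]
  have hinner : ∀ y : ZSite d,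
      ∑' y'' : ZSite d, ξ ^ (2 * d) * (negLapZ ξ (Cxi d ξ) y'' * Cxi d ξ (y'' - y) *
        (pdiffZ ξ⁻¹ μ (Cxi d ξ) y - pdiffAdjZ ξ⁻¹ μ (Cxi d ξ) y)) =
      ξ ^ d * Cxi d ξ y * (pdiffZ ξ⁻¹ μ (Cxi d ξ) y - pdiffAdjZ ξ⁻¹ μ (Cxi d ξ) y) -
        ξ ^ d * convZ ξ (Cxi d ξ) y * (pdiffZ ξ⁻¹ μ (Cxi d ξ) y - pdiffAdjZ ξ⁻¹ μ (Cxi d ξ) y) :=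
    fun y => inner338_Cxi hξ y _
  rw [tsum_congr hinner, (summable_outer_C hξ μ).tsum_sub (summable_outer_conv hξ μ)]
  have hA : ∑' y : ZSite d, ξ ^ d * Cxi d ξ y * (pdiffZ ξ⁻¹ μ (Cxi d ξ) y - pdiffAdjZ ξ⁻¹ μ (Cxi d ξ) y) =
      ∑' y : ZSite d, ξ ^ d * (Cxi d ξ y * ((Cxi d ξ (y + unitVec μ) - Cxi d ξ (y - unitVec μ)) / ξ)) :=
    tsum_congr fun y => by rw [pdiffZ_sub_pdiffAdjZ]; ring
  have hB : ∑' y : ZSite d, ξ ^ d * convZ ξ (Cxi d ξ) y * (pdiffZ ξ⁻¹ μ (Cxi d ξ) y - pdiffAdjZ ξ⁻¹ μ (Cxi d ξ) y) =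
      ∑' y : ZSite d, ξ ^ d * (convZ ξ (Cxi d ξ) y * ((Cxi d ξ (y + unitVec μ) - Cxi d ξ (y - unitVec μ)) / ξ)) :=
    tsum_congr fun y => by rw [pdiffZ_sub_pdiffAdjZ]; ring
  rw [hA, hB]
  ring

/-- **(3.38)** p. 444 [PDF 34], FIRST member = MIDDLE member for C^ξ (ξ > 0; every external point y′, every μ) —
PROVED from seat p03's `B3Eq324Parseval.eq338_holds` (first = last, convolution theorem on T^d) and `mid338_eq_last338`
(T1: the printed direct route — summation by parts in y and Σ_ν∂^ξ_ν∂^{ξ*}_ν = −Δ^ξ — is not replayed).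
[cite: Balaban1983Higgs3, (3.38) p.444] -/
theorem lhs338_eq_mid338 (hξ : 0 < ξ) (q3 : ℝ) (y' : ZSite d) (μ : Fin d) :
    lhs338 ξ q3 (Cxi d ξ) y' μ = mid338 d ξ q3 μ := by
  rw [B3Eq324Parseval.eq338_holds hξ q3 y' μ, mid338_eq_last338 hξ q3 μ]

/-- kernel: hence the middle member of (3.38) for C^ξ vanishes as well (*"= 0, (3.38) because the functions which we are
summing are odd"*, `B3Sect3TriangleGraphs.last338_Cxi_eq_zero`). [cite: Balaban1983Higgs3, (3.38) p.444] -/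
theorem mid338_eq_zero (hξ : 0 < ξ) (q3 : ℝ) (μ : Fin d) : mid338 d ξ q3 μ = 0 := by
  rw [mid338_eq_last338 hξ q3 μ, last338_Cxi_eq_zero]

/-- **(3.38) for C^ξ, all four printed members** (ξ > 0): first = middle, middle = last, last = 0.
[cite: Balaban1983Higgs3, (3.38) p.444] -/
theorem eq338_chain (hξ : 0 < ξ) (q3 : ℝ) (y' : ZSite d) (μ : Fin d) :
    lhs338 ξ q3 (Cxi d ξ) y' μ = mid338 d ξ q3 μ ∧ mid338 d ξ q3 μ = last338 ξ q3 (Cxi d ξ) μ ∧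
      last338 ξ q3 (Cxi d ξ) μ = 0 :=
  ⟨lhs338_eq_mid338 hξ q3 y' μ, mid338_eq_last338 hξ q3 μ, last338_Cxi_eq_zero ξ q3 μ⟩

end Reduction

/-! ## v1.1 (append-only): the printed direct route of (3.38), first member = middle member -/

section DirectRoute

/-! #### ℓ¹ × ℓ^∞ bookkeeping on ℤ^d (kernel lemmas) -/

/-- kernel: a summable kernel is bounded by its ℓ¹ norm. [folklore] -/
private theorem abs_le_l1 {f : ZSite d → ℝ} (hf : Summable fun z => |f z|) (z : ZSite d) : |f z| ≤ ∑' w, |f w| :=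
  hf.le_tsum z fun _ _ => abs_nonneg _

/-- kernel: ℓ¹ × ℓ^∞ products are summable. [folklore] -/
private theorem summable_mul_of_bdd {f g : ZSite d → ℝ} {M : ℝ} (hf : Summable fun z => |f z|)
    (hg : ∀ z, |g z| ≤ M) : Summable fun z => f z * g z := by
  refine Summable.of_norm_bounded (hf.mul_right M) fun z => ?_
  rw [Real.norm_eq_abs, abs_mul]
  exact mul_le_mul_of_nonneg_left (hg z) (abs_nonneg _)

/-- kernel: translates of ℓ¹ kernels are ℓ¹. [folklore] -/
private theorem summable_abs_shift {f : ZSite d → ℝ} (hf : Summable fun z => |f z|) (a : ZSite d) :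
    Summable fun z => |f (z + a)| :=
  (Equiv.summable_iff (Equiv.addRight a) (f := fun z => |f z|)).mpr hf

/-- kernel: reflected translates of ℓ¹ kernels are ℓ¹ (w ↦ f(a − w)). [folklore] -/
private theorem summable_abs_subLeft {f : ZSite d → ℝ} (hf : Summable fun z => |f z|) (a : ZSite d) :
    Summable fun z => |f (a - z)| :=
  (Equiv.summable_iff (Equiv.subLeft a) (f := fun z => |f z|)).mpr hf

/-- kernel: forward differences of ℓ¹ kernels are ℓ¹. [folklore] -/
private theorem summable_abs_pdiffZ {f : ZSite d → ℝ} (hf : Summable fun z => |f z|) (c : ℝ) (ν : Fin d) :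
    Summable fun z => |pdiffZ c ν f z| := by
  have h : Summable fun z => c * (f (z + unitVec ν) - f z) :=
    ((summable_abs_shift hf _).of_abs.sub hf.of_abs).mul_left c
  exact h.abs

/-- kernel: backward differences of ℓ¹ kernels are ℓ¹. [folklore] -/
private theorem summable_abs_pdiffAdjZ {f : ZSite d → ℝ} (hf : Summable fun z => |f z|) (c : ℝ) (ν : Fin d) :
    Summable fun z => |pdiffAdjZ c ν f z| := by
  have h : Summable fun z => c * (f (z - unitVec ν) - f z) := by
    refine ((?_ : Summable fun z => f (z - unitVec ν)).sub hf.of_abs).mul_left c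
    have := (summable_abs_shift hf (-unitVec ν)).of_abs
    simpa only [sub_eq_add_neg] using this
  exact h.abs

/-- kernel: forward differences of bounded kernels are bounded. [folklore] -/
private theorem abs_pdiffZ_le {g : ZSite d → ℝ} {M : ℝ} (hg : ∀ z, |g z| ≤ M) (c : ℝ) (ν : Fin d) (z : ZSite d) :
    |pdiffZ c ν g z| ≤ |c| * (M + M) := by
  simp only [pdiffZ]
  rw [abs_mul]
  exact mul_le_mul_of_nonneg_left ((abs_sub _ _).trans (add_le_add (hg _) (hg _))) (abs_nonneg _)

/-- kernel: backward differences of bounded kernels are bounded. [folklore] -/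
private theorem abs_pdiffAdjZ_le {g : ZSite d → ℝ} {M : ℝ} (hg : ∀ z, |g z| ≤ M) (c : ℝ) (ν : Fin d) (z : ZSite d) :
    |pdiffAdjZ c ν g z| ≤ |c| * (M + M) := by
  simp only [pdiffAdjZ]
  rw [abs_mul]
  exact mul_le_mul_of_nonneg_left ((abs_sub _ _).trans (add_le_add (hg _) (hg _))) (abs_nonneg _)

/-- kernel: −Δ^ξ of a bounded kernel is bounded. [folklore] -/
private theorem abs_negLapZ_le {g : ZSite d → ℝ} {M : ℝ} (hg : ∀ z, |g z| ≤ M) (ξ : ℝ) (z : ZSite d) :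
    |negLapZ ξ g z| ≤ d * (ξ⁻¹ ^ 2 * (2 * M + M + M)) := by
  unfold negLapZ
  calc |∑ μ : Fin d, ξ⁻¹ ^ 2 * (2 * g z - g (z + unitVec μ) - g (z - unitVec μ))|
      ≤ ∑ μ : Fin d, |ξ⁻¹ ^ 2 * (2 * g z - g (z + unitVec μ) - g (z - unitVec μ))| := Finset.abs_sum_le_sum_abs _ _
    _ ≤ ∑ _μ : Fin d, ξ⁻¹ ^ 2 * (2 * M + M + M) := by
        refine Finset.sum_le_sum fun μ _ => ?_
        rw [abs_mul, abs_of_nonneg (by positivity : (0:ℝ) ≤ ξ⁻¹ ^ 2)]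
        refine mul_le_mul_of_nonneg_left ?_ (by positivity)
        have h2 : |2 * g z| ≤ 2 * M := by rw [abs_mul, abs_two]; exact mul_le_mul_of_nonneg_left (hg z) zero_le_two
        calc |2 * g z - g (z + unitVec μ) - g (z - unitVec μ)|
            ≤ |2 * g z - g (z + unitVec μ)| + |g (z - unitVec μ)| := abs_sub _ _
          _ ≤ (|2 * g z| + |g (z + unitVec μ)|) + |g (z - unitVec μ)| := by gcongr; exact abs_sub _ _
          _ ≤ (2 * M + M) + M := by gcongr <;> apply hg
    _ = d * (ξ⁻¹ ^ 2 * (2 * M + M + M)) := by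
        rw [Finset.sum_const, Finset.card_univ, Fintype.card_fin, nsmul_eq_mul]

/-- kernel: forward and backward differences commute (constant coefficients on ℤ^d). [folklore] -/
private theorem pdiffZ_pdiffAdjZ_comm' (a b : ℝ) (μ ν : Fin d) (f : ZSite d → ℝ) (z : ZSite d) :
    pdiffZ a μ (pdiffAdjZ b ν f) z = pdiffAdjZ b ν (pdiffZ a μ f) z := by
  simp only [pdiffZ, pdiffAdjZ]
  rw [show z + unitVec μ - unitVec ν = z - unitVec ν + unitVec μ by abel]
  ring

/-- kernel: backward differences in two directions commute. [folklore] -/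
private theorem pdiffAdjZ_comm (a b : ℝ) (μ ν : Fin d) (f : ZSite d → ℝ) (z : ZSite d) :
    pdiffAdjZ a μ (pdiffAdjZ b ν f) z = pdiffAdjZ b ν (pdiffAdjZ a μ f) z := by
  simp only [pdiffAdjZ]
  rw [show z - unitVec μ - unitVec ν = z - unitVec ν - unitVec μ by abel]
  ring

/-- kernel: −Δ^ξ = Σ_ν ∂^{ξ*}_ν∂^ξ_ν as well (the factors commute). [folklore] -/
private theorem sum_pdiffAdjZ_pdiffZ (ξ : ℝ) (f : ZSite d → ℝ) (y : ZSite d) :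
    ∑ ν : Fin d, pdiffAdjZ ξ⁻¹ ν (pdiffZ ξ⁻¹ ν f) y = negLapZ ξ f y := by
  rw [← sum_pdiffZ_pdiffAdjZ ξ f y]
  exact Finset.sum_congr rfl fun ν _ => (pdiffZ_pdiffAdjZ_comm' _ _ ν ν f y).symm

/-- kernel: ∂^{ξ*}_μ is additive over finite sums of kernels. [folklore] -/
private theorem pdiffAdjZ_finset_sum (c : ℝ) (μ : Fin d) (h : Fin d → ZSite d → ℝ) (z : ZSite d) :
    pdiffAdjZ c μ (fun v => ∑ ν : Fin d, h ν v) z = ∑ ν : Fin d, pdiffAdjZ c μ (h ν) z := by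
  simp only [pdiffAdjZ, ← Finset.sum_sub_distrib, Finset.mul_sum]

/-- kernel: ∂^ξ_μ is additive over finite sums of kernels. [folklore] -/
private theorem pdiffZ_finset_sum (c : ℝ) (μ : Fin d) (h : Fin d → ZSite d → ℝ) (z : ZSite d) :
    pdiffZ c μ (fun v => ∑ ν : Fin d, h ν v) z = ∑ ν : Fin d, pdiffZ c μ (h ν) z := by
  simp only [pdiffZ, ← Finset.sum_sub_distrib, Finset.mul_sum]

/-- kernel: −Δ^ξ of an even kernel is even. [folklore] -/
private theorem negLapZ_neg_of_even (ξ : ℝ) (f : ZSite d → ℝ) (hf : ∀ y, f (-y) = f y) (y : ZSite d) :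
    negLapZ ξ f (-y) = negLapZ ξ f y := by
  unfold negLapZ
  refine Finset.sum_congr rfl fun μ _ => ?_
  rw [hf, show -y + unitVec μ = -(y - unitVec μ) by abel, hf, show -y - unitVec μ = -(y + unitVec μ) by abel, hf]
  ring

/-! #### summation by parts on ξℤ^d -/

/-- kernel (summation by parts on ξℤ^d): Σ_u (∂^ξ_νf)(u)g(u) = Σ_u f(u)(∂^{ξ*}_νg)(u) for f ∈ ℓ¹, g bounded. [folklore] -/
private theorem tsum_pdiffZ_mul {f g : ZSite d → ℝ} {M : ℝ} (hf : Summable fun z => |f z|)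
    (hg : ∀ z, |g z| ≤ M) (c : ℝ) (ν : Fin d) :
    ∑' u, pdiffZ c ν f u * g u = ∑' u, f u * pdiffAdjZ c ν g u := by
  have h1 : Summable fun u => f (u + unitVec ν) * g u := summable_mul_of_bdd (summable_abs_shift hf _) hg
  have h2 : Summable fun u => f u * g u := summable_mul_of_bdd hf hg
  have h3 : Summable fun u => f u * g (u - unitVec ν) := summable_mul_of_bdd hf fun u => hg _
  have key : ∑' u, f (u + unitVec ν) * g u = ∑' u, f u * g (u - unitVec ν) := by
    rw [← Equiv.tsum_eq (Equiv.addRight (unitVec ν)) (fun u => f u * g (u - unitVec ν))]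
    simp only [Equiv.coe_addRight, add_sub_cancel_right]
  calc ∑' u, pdiffZ c ν f u * g u
      = ∑' u, (c * (f (u + unitVec ν) * g u) - c * (f u * g u)) := tsum_congr fun u => by simp only [pdiffZ]; ring
    _ = c * ∑' u, f (u + unitVec ν) * g u - c * ∑' u, f u * g u := by
        rw [(h1.mul_left c).tsum_sub (h2.mul_left c), tsum_mul_left, tsum_mul_left]
    _ = c * ∑' u, f u * g (u - unitVec ν) - c * ∑' u, f u * g u := by rw [key]
    _ = ∑' u, (c * (f u * g (u - unitVec ν)) - c * (f u * g u)) := by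
        rw [(h3.mul_left c).tsum_sub (h2.mul_left c), tsum_mul_left, tsum_mul_left]
    _ = ∑' u, f u * pdiffAdjZ c ν g u := tsum_congr fun u => by simp only [pdiffAdjZ]; ring

/-- kernel (summation by parts, adjoint form): Σ_u (∂^{ξ*}_νf)(u)g(u) = Σ_u f(u)(∂^ξ_νg)(u) for f ∈ ℓ¹, g bounded. [folklore] -/
private theorem tsum_pdiffAdjZ_mul {f g : ZSite d → ℝ} {M : ℝ} (hf : Summable fun z => |f z|)
    (hg : ∀ z, |g z| ≤ M) (c : ℝ) (ν : Fin d) :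
    ∑' u, pdiffAdjZ c ν f u * g u = ∑' u, f u * pdiffZ c ν g u := by
  have h1 : Summable fun u => f (u - unitVec ν) * g u := by
    have := summable_mul_of_bdd (summable_abs_shift hf (-unitVec ν)) hg
    simpa only [sub_eq_add_neg] using this
  have h2 : Summable fun u => f u * g u := summable_mul_of_bdd hf hg
  have h3 : Summable fun u => f u * g (u + unitVec ν) := summable_mul_of_bdd hf fun u => hg _
  have key : ∑' u, f (u - unitVec ν) * g u = ∑' u, f u * g (u + unitVec ν) := by
    rw [← Equiv.tsum_eq (Equiv.addRight (unitVec ν)) (fun u => f (u - unitVec ν) * g u)]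
    simp only [Equiv.coe_addRight, add_sub_cancel_right]
  calc ∑' u, pdiffAdjZ c ν f u * g u
      = ∑' u, (c * (f (u - unitVec ν) * g u) - c * (f u * g u)) := tsum_congr fun u => by simp only [pdiffAdjZ]; ring
    _ = c * ∑' u, f (u - unitVec ν) * g u - c * ∑' u, f u * g u := by
        rw [(h1.mul_left c).tsum_sub (h2.mul_left c), tsum_mul_left, tsum_mul_left]
    _ = c * ∑' u, f u * g (u + unitVec ν) - c * ∑' u, f u * g u := by rw [key]
    _ = ∑' u, (c * (f u * g (u + unitVec ν)) - c * (f u * g u)) := by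
        rw [(h3.mul_left c).tsum_sub (h2.mul_left c), tsum_mul_left, tsum_mul_left]
    _ = ∑' u, f u * pdiffZ c ν g u := tsum_congr fun u => by simp only [pdiffZ]; ring

/-! #### the lattice correlation Σ_w f(w)g(w − u) and its calculus -/

/-- kernel: the lattice correlation Σ_w f(w)g(w − u) (for even kernels = the convolution up to ξ^d, cf.
`B3Sect3TriangleGraphs.convZ`) is bounded, |Σ_w f(w)g(w − u)| ≤ ‖f‖₁·sup|g|. [folklore] -/
private theorem abs_corrZ_le {f g : ZSite d → ℝ} {M : ℝ} (hf : Summable fun z => |f z|) (hg : ∀ z, |g z| ≤ M)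
    (u : ZSite d) : |∑' w, f w * g (w - u)| ≤ (∑' w, |f w|) * M := by
  have hs : Summable fun w => f w * g (w - u) := summable_mul_of_bdd hf fun w => hg _
  have h1 : |∑' w, f w * g (w - u)| ≤ ∑' w, |f w * g (w - u)| := by
    have := norm_tsum_le_tsum_norm (f := fun w => f w * g (w - u)) (by simpa only [Real.norm_eq_abs] using hs.abs)
    simpa only [Real.norm_eq_abs] using this
  refine h1.trans ?_
  rw [← tsum_mul_right]
  refine (hs.abs.tsum_le_tsum (fun w => ?_) (hf.mul_right M))
  rw [abs_mul]
  exact mul_le_mul_of_nonneg_left (hg _) (abs_nonneg _)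

/-- kernel: a forward difference on the second factor comes out as a backward difference,
Σ_w f(w)(∂^ξ_νg)(w − u) = ∂^{ξ*}_ν[u ↦ Σ_w f(w)g(w − u)]. [folklore] -/
private theorem corrZ_pdiffZ {f g : ZSite d → ℝ} {M : ℝ} (hf : Summable fun z => |f z|) (hg : ∀ z, |g z| ≤ M)
    (c : ℝ) (ν : Fin d) (u : ZSite d) :
    (∑' w, f w * pdiffZ c ν g (w - u)) = pdiffAdjZ c ν (fun v => ∑' w, f w * g (w - v)) u := by
  simp only [pdiffZ, pdiffAdjZ]
  have h1 : Summable fun w => f w * g (w - (u - unitVec ν)) := summable_mul_of_bdd hf fun w => hg _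
  have h2 : Summable fun w => f w * g (w - u) := summable_mul_of_bdd hf fun w => hg _
  rw [← h1.tsum_sub h2, ← tsum_mul_left]
  refine tsum_congr fun w => ?_
  rw [show w - u + unitVec ν = w - (u - unitVec ν) by abel]
  ring

/-- kernel: a backward difference on the second factor comes out as a forward difference,
Σ_w f(w)(∂^{ξ*}_νg)(w − u) = ∂^ξ_ν[u ↦ Σ_w f(w)g(w − u)]. [folklore] -/
private theorem corrZ_pdiffAdjZ {f g : ZSite d → ℝ} {M : ℝ} (hf : Summable fun z => |f z|) (hg : ∀ z, |g z| ≤ M)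
    (c : ℝ) (ν : Fin d) (u : ZSite d) :
    (∑' w, f w * pdiffAdjZ c ν g (w - u)) = pdiffZ c ν (fun v => ∑' w, f w * g (w - v)) u := by
  simp only [pdiffZ, pdiffAdjZ]
  have h1 : Summable fun w => f w * g (w - (u + unitVec ν)) := summable_mul_of_bdd hf fun w => hg _
  have h2 : Summable fun w => f w * g (w - u) := summable_mul_of_bdd hf fun w => hg _
  rw [← h1.tsum_sub h2, ← tsum_mul_left]
  refine tsum_congr fun w => ?_
  rw [show w - u - unitVec ν = w - (u + unitVec ν) by abel]
  ring

/-- kernel: the correlation is additive over finite sums in the second factor (ℓ¹ × bounded). [folklore] -/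
private theorem corrZ_finset_sum {f : ZSite d → ℝ} {h : Fin d → ZSite d → ℝ} {M : ℝ} (hf : Summable fun z => |f z|)
    (hh : ∀ ν z, |h ν z| ≤ M) (u : ZSite d) :
    (∑' w, f w * ∑ ν : Fin d, h ν (w - u)) = ∑ ν : Fin d, ∑' w, f w * h ν (w - u) := by
  simp only [Finset.mul_sum]
  exact Summable.tsum_finsetSum (fun ν _ => summable_mul_of_bdd hf fun w => hh ν _)

/-- kernel: for even kernels the correlation is symmetric, Σ_w f(w)g(w − u) = Σ_w g(w)f(w − u). [folklore] -/
private theorem corrZ_comm_of_even {f g : ZSite d → ℝ} (hf : ∀ z, f (-z) = f z) (hg : ∀ z, g (-z) = g z)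
    (u : ZSite d) : (∑' w, f w * g (w - u)) = ∑' w, g w * f (w - u) := by
  calc ∑' w, f w * g (w - u) = ∑' w, f (-w) * g (-w - u) :=
        (Equiv.tsum_eq (Equiv.neg (ZSite d)) (fun w => f w * g (w - u))).symm
    _ = ∑' w, g (w + u) * f (w + u - u) := tsum_congr fun w => by
        rw [hf, show -w - u = -(w + u) by abel, hg, add_sub_cancel_right]; ring
    _ = ∑' w, g w * f (w - u) := Equiv.tsum_eq (Equiv.addRight u) (fun w => g w * f (w - u))

/-- kernel: Σ_w f(w)(−Δ^ξg)(w − u) = −Δ^ξ[u ↦ Σ_w f(w)g(w − u)] (ℓ¹ × bounded). [folklore] -/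
private theorem corrZ_negLapZ {f g : ZSite d → ℝ} {M : ℝ} (hf : Summable fun z => |f z|) (hg : ∀ z, |g z| ≤ M)
    (ξ : ℝ) (u : ZSite d) : (∑' w, f w * negLapZ ξ g (w - u)) = negLapZ ξ (fun v => ∑' w, f w * g (w - v)) u := by
  have e1 : (∑' w, f w * negLapZ ξ g (w - u)) = ∑' w, f w * ∑ ν : Fin d, pdiffZ ξ⁻¹ ν (pdiffAdjZ ξ⁻¹ ν g) (w - u) :=
    tsum_congr fun w => by rw [sum_pdiffZ_pdiffAdjZ]
  rw [e1, corrZ_finset_sum hf (fun ν z => abs_pdiffZ_le (abs_pdiffAdjZ_le hg _ ν) _ ν z), ← sum_pdiffAdjZ_pdiffZ]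
  refine Finset.sum_congr rfl fun ν _ => ?_
  rw [corrZ_pdiffZ hf (abs_pdiffAdjZ_le hg _ ν) _ ν]
  have hin : (fun v => ∑' w, f w * pdiffAdjZ ξ⁻¹ ν g (w - v)) = pdiffZ ξ⁻¹ ν (fun v => ∑' w, f w * g (w - v)) :=
    funext fun v => corrZ_pdiffAdjZ hf hg _ ν v
  rw [hin]

/-! #### the printed direct route of (3.38): first member = middle member -/

/-- **(3.38) p. 444 [PDF 34], FIRST member = MIDDLE member, by the printed route** — PROVED for every EVEN kernel C on
ξℤ^d with Σ_z|C(z)| < ∞ (ξ ≠ 0 not even needed): summation by parts in y (moving ∂^ξ_ν, ∂^{ξ*}_μ between the factors of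
the lattice correlation) and Σ_ν∂^{ξ*}_ν∂^ξ_ν = Σ_ν∂^ξ_ν∂^{ξ*}_ν = −Δ^ξ.  With P(u) = Σ_w C(w)C(w − u) both members equal
−q³ξ^{2d}Σ_u[(∂^ξ_μC)(u) − (∂^{ξ*}_μC)(u)](−Δ^ξP)(u).  (v1 obtained this for C^ξ only, through p03's first = last.)
[cite: Balaban1983Higgs3, (3.38) p.444] -/
theorem lhs338_eq_mid338Of (ξ q3 : ℝ) (C : ZSite d → ℝ) (hC : ∀ z, C (-z) = C z) (h0 : Summable fun z => |C z|)
    (y' : ZSite d) (μ : Fin d) : lhs338 ξ q3 C y' μ = mid338Of ξ q3 C μ := by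
  -- abbreviations
  set c : ℝ := ξ⁻¹ with hc
  set B : ℝ := ∑' w, |C w| with hB
  have hCb : ∀ z, |C z| ≤ B := abs_le_l1 h0
  set P : ZSite d → ℝ := fun v => ∑' w, C w * C (w - v) with hP
  have hPb : ∀ z, |P z| ≤ B * B := fun z => abs_corrZ_le h0 hCb z
  set N : ZSite d → ℝ := negLapZ ξ P with hN
  have hNb : ∀ z, |N z| ≤ d * (ξ⁻¹ ^ 2 * (2 * (B * B) + B * B + B * B)) := fun z => abs_negLapZ_le hPb ξ z
  -- the common value
  set V : ℝ := ξ ^ (2 * d) * ∑' u, (pdiffZ c μ C u - pdiffAdjZ c μ C u) * N u with hV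
  -- ===== the middle member =====
  have hM : mid338Of ξ q3 C μ = -q3 * V := by
    unfold mid338Of
    congr 1
    -- inner sum at fixed y
    have hin : ∀ y : ZSite d, ∑' y'', ξ ^ (2 * d) * (negLapZ ξ C y'' * C (y'' - y) *
        (pdiffZ ξ⁻¹ μ C y - pdiffAdjZ ξ⁻¹ μ C y)) =
        ξ ^ (2 * d) * ((pdiffZ c μ C y - pdiffAdjZ c μ C y) * N y) := by
      intro y
      have e1 : ∑' y'', ξ ^ (2 * d) * (negLapZ ξ C y'' * C (y'' - y) * (pdiffZ ξ⁻¹ μ C y - pdiffAdjZ ξ⁻¹ μ C y)) =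
          ξ ^ (2 * d) * (pdiffZ c μ C y - pdiffAdjZ c μ C y) * ∑' y'', negLapZ ξ C y'' * C (y'' - y) := by
        rw [← tsum_mul_left]; exact tsum_congr fun y'' => by rw [hc]; ring
      rw [e1]
      have e2 : ∑' y'', negLapZ ξ C y'' * C (y'' - y) = N y := by
        rw [corrZ_comm_of_even (negLapZ_neg_of_even ξ C hC) hC, hN, hP]
        exact corrZ_negLapZ h0 hCb ξ y
      rw [e2]; ring
    rw [tsum_congr hin, tsum_mul_left]
  -- ===== the first member =====
  -- the inner y''-sum at fixed y, in closed form
  have hinner : ∀ y : ZSite d,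
      ∑' y'', ξ ^ (2 * d) * ∑ ν : Fin d,
        (pdiffZ ξ⁻¹ ν C (y' - y) * pdiffZ ξ⁻¹ μ (pdiffAdjZ ξ⁻¹ ν C) (y - y'') * C (y' - y'') -
          pdiffZ ξ⁻¹ ν (pdiffAdjZ ξ⁻¹ μ C) (y' - y) * pdiffAdjZ ξ⁻¹ ν C (y - y'') * C (y' - y'')) =
      ξ ^ (2 * d) * ∑ ν : Fin d,
        (pdiffZ c ν C (y' - y) * pdiffAdjZ c μ (pdiffZ c ν P) (y' - y) -
          pdiffZ c ν (pdiffAdjZ c μ C) (y' - y) * pdiffZ c ν P (y' - y)) := by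
    intro y
    -- bounded second factors
    have hB1 : ∀ ν z, |pdiffZ ξ⁻¹ μ (pdiffAdjZ ξ⁻¹ ν C) z| ≤ |ξ⁻¹| * (|ξ⁻¹| * (B + B) + |ξ⁻¹| * (B + B)) :=
      fun ν z => abs_pdiffZ_le (abs_pdiffAdjZ_le hCb _ ν) _ μ z
    have hB2 : ∀ ν z, |pdiffAdjZ ξ⁻¹ ν C z| ≤ |ξ⁻¹| * (B + B) := fun ν z => abs_pdiffAdjZ_le hCb _ ν z
    -- the y''-families are summable: bounded × (w ↦ C (y' − w)) ∈ ℓ¹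
    have hCy : Summable fun w => |C (y' - w)| := summable_abs_subLeft h0 y'
    have sA : ∀ ν, Summable fun y'' => pdiffZ ξ⁻¹ μ (pdiffAdjZ ξ⁻¹ ν C) (y - y'') * C (y' - y'') := by
      intro ν
      have := summable_mul_of_bdd hCy (fun w => hB1 ν (y - w))
      exact this.congr fun w => by ring
    have sB : ∀ ν, Summable fun y'' => pdiffAdjZ ξ⁻¹ ν C (y - y'') * C (y' - y'') := by
      intro ν
      have := summable_mul_of_bdd hCy (fun w => hB2 ν (y - w))
      exact this.congr fun w => by ring
    -- closed forms of the two y''-sums (substitution y'' = y' − w)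
    have cfA : ∀ ν, ∑' y'', pdiffZ ξ⁻¹ μ (pdiffAdjZ ξ⁻¹ ν C) (y - y'') * C (y' - y'') =
        pdiffAdjZ c μ (pdiffZ c ν P) (y' - y) := by
      intro ν
      have e1 : ∑' y'', pdiffZ ξ⁻¹ μ (pdiffAdjZ ξ⁻¹ ν C) (y - y'') * C (y' - y'') =
          ∑' w, C w * pdiffZ ξ⁻¹ μ (pdiffAdjZ ξ⁻¹ ν C) (w - (y' - y)) := by
        rw [← Equiv.tsum_eq (Equiv.subLeft y') _]
        refine tsum_congr fun w => ?_
        simp only [Equiv.subLeft_apply]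
        rw [show y - (y' - w) = w - (y' - y) by abel, sub_sub_cancel]
        ring
      rw [e1, corrZ_pdiffZ h0 (abs_pdiffAdjZ_le hCb _ ν) _ μ]
      have hin : (fun v => ∑' w, C w * pdiffAdjZ ξ⁻¹ ν C (w - v)) = pdiffZ ξ⁻¹ ν P := by
        rw [hP]; exact funext fun v => corrZ_pdiffAdjZ h0 hCb _ ν v
      rw [hin]
    have cfB : ∀ ν, ∑' y'', pdiffAdjZ ξ⁻¹ ν C (y - y'') * C (y' - y'') = pdiffZ c ν P (y' - y) := by
      intro ν
      have e1 : ∑' y'', pdiffAdjZ ξ⁻¹ ν C (y - y'') * C (y' - y'') =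
          ∑' w, C w * pdiffAdjZ ξ⁻¹ ν C (w - (y' - y)) := by
        rw [← Equiv.tsum_eq (Equiv.subLeft y') _]
        refine tsum_congr fun w => ?_
        simp only [Equiv.subLeft_apply]
        rw [show y - (y' - w) = w - (y' - y) by abel, sub_sub_cancel]
        ring
      rw [e1, corrZ_pdiffAdjZ h0 hCb _ ν, hP]
    -- assemble: pull out the constants, split Σ_ν and the difference
    have sT : ∀ ν, Summable fun y'' =>
        (pdiffZ ξ⁻¹ ν C (y' - y) * pdiffZ ξ⁻¹ μ (pdiffAdjZ ξ⁻¹ ν C) (y - y'') * C (y' - y'') -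
          pdiffZ ξ⁻¹ ν (pdiffAdjZ ξ⁻¹ μ C) (y' - y) * pdiffAdjZ ξ⁻¹ ν C (y - y'') * C (y' - y'')) := by
      intro ν
      have := ((sA ν).mul_left (pdiffZ ξ⁻¹ ν C (y' - y))).sub ((sB ν).mul_left (pdiffZ ξ⁻¹ ν (pdiffAdjZ ξ⁻¹ μ C) (y' - y)))
      exact this.congr fun w => by ring
    rw [tsum_mul_left, Summable.tsum_finsetSum (fun ν _ => sT ν)]
    congr 1
    refine Finset.sum_congr rfl fun ν _ => ?_
    have e3 : ∑' y'', (pdiffZ ξ⁻¹ ν C (y' - y) * pdiffZ ξ⁻¹ μ (pdiffAdjZ ξ⁻¹ ν C) (y - y'') * C (y' - y'') -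
          pdiffZ ξ⁻¹ ν (pdiffAdjZ ξ⁻¹ μ C) (y' - y) * pdiffAdjZ ξ⁻¹ ν C (y - y'') * C (y' - y'')) =
        pdiffZ ξ⁻¹ ν C (y' - y) * ∑' y'', pdiffZ ξ⁻¹ μ (pdiffAdjZ ξ⁻¹ ν C) (y - y'') * C (y' - y'') -
          pdiffZ ξ⁻¹ ν (pdiffAdjZ ξ⁻¹ μ C) (y' - y) * ∑' y'', pdiffAdjZ ξ⁻¹ ν C (y - y'') * C (y' - y'') := by
      rw [← tsum_mul_left, ← tsum_mul_left, ← ((sA ν).mul_left _).tsum_sub ((sB ν).mul_left _)]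
      exact tsum_congr fun w => by ring
    rw [e3, cfA ν, cfB ν]
  -- the outer sum: translate y ↦ u = y' − y, then summation by parts term by term
  have hL : lhs338 ξ q3 C y' μ = -q3 * V := by
    unfold lhs338
    congr 1
    rw [tsum_congr hinner]
    -- reindex y ↦ y' - y
    rw [show (∑' y : ZSite d, ξ ^ (2 * d) * ∑ ν : Fin d,
          (pdiffZ c ν C (y' - y) * pdiffAdjZ c μ (pdiffZ c ν P) (y' - y) -
            pdiffZ c ν (pdiffAdjZ c μ C) (y' - y) * pdiffZ c ν P (y' - y))) =
        ∑' u : ZSite d, ξ ^ (2 * d) * ∑ ν : Fin d,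
          (pdiffZ c ν C u * pdiffAdjZ c μ (pdiffZ c ν P) u - pdiffZ c ν (pdiffAdjZ c μ C) u * pdiffZ c ν P u) from
      Equiv.tsum_eq (Equiv.subLeft y') (fun u => ξ ^ (2 * d) * ∑ ν : Fin d,
          (pdiffZ c ν C u * pdiffAdjZ c μ (pdiffZ c ν P) u - pdiffZ c ν (pdiffAdjZ c μ C) u * pdiffZ c ν P u))]
    rw [tsum_mul_left, hV]
    congr 1
    -- boundedness of the P-factors and ℓ¹-ness of the C-factors
    have bP1 : ∀ ν z, |pdiffZ c ν P z| ≤ |c| * (B * B + B * B) := fun ν z => abs_pdiffZ_le hPb _ ν z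
    have bP2 : ∀ ν z, |pdiffAdjZ c μ (pdiffZ c ν P) z| ≤ |c| * (|c| * (B * B + B * B) + |c| * (B * B + B * B)) :=
      fun ν z => abs_pdiffAdjZ_le (bP1 ν) _ μ z
    have bP3 : ∀ ν z, |pdiffAdjZ c ν (pdiffZ c ν P) z| ≤ |c| * (|c| * (B * B + B * B) + |c| * (B * B + B * B)) :=
      fun ν z => abs_pdiffAdjZ_le (bP1 ν) _ ν z
    have l1 : ∀ ν, Summable fun z => |pdiffZ c ν C z| := fun ν => summable_abs_pdiffZ h0 _ ν
    have l2 : Summable fun z => |pdiffAdjZ c μ C z| := summable_abs_pdiffAdjZ h0 _ μ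
    have l3 : ∀ ν, Summable fun z => |pdiffZ c ν (pdiffAdjZ c μ C) z| := fun ν => summable_abs_pdiffZ l2 _ ν
    have s1 : ∀ ν, Summable fun u => pdiffZ c ν C u * pdiffAdjZ c μ (pdiffZ c ν P) u :=
      fun ν => summable_mul_of_bdd (l1 ν) (bP2 ν)
    have s2 : ∀ ν, Summable fun u => pdiffZ c ν (pdiffAdjZ c μ C) u * pdiffZ c ν P u :=
      fun ν => summable_mul_of_bdd (l3 ν) (bP1 ν)
    rw [Summable.tsum_finsetSum (fun ν _ => (s1 ν).sub (s2 ν))]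
    -- summation by parts in each ν-term
    have t1 : ∀ ν, ∑' u, pdiffZ c ν C u * pdiffAdjZ c μ (pdiffZ c ν P) u =
        ∑' u, C u * pdiffAdjZ c ν (pdiffAdjZ c μ (pdiffZ c ν P)) u :=
      fun ν => tsum_pdiffZ_mul h0 (bP2 ν) c ν
    have t2 : ∀ ν, ∑' u, pdiffZ c ν (pdiffAdjZ c μ C) u * pdiffZ c ν P u =
        ∑' u, C u * pdiffZ c μ (pdiffAdjZ c ν (pdiffZ c ν P)) u := by
      intro ν
      rw [tsum_pdiffZ_mul l2 (bP1 ν) c ν, tsum_pdiffAdjZ_mul h0 (bP3 ν) c μ]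
    have e4 : ∀ ν, ∑' u, (pdiffZ c ν C u * pdiffAdjZ c μ (pdiffZ c ν P) u -
        pdiffZ c ν (pdiffAdjZ c μ C) u * pdiffZ c ν P u) =
        ∑' u, C u * (pdiffAdjZ c ν (pdiffAdjZ c μ (pdiffZ c ν P)) u - pdiffZ c μ (pdiffAdjZ c ν (pdiffZ c ν P)) u) := by
      intro ν
      rw [(s1 ν).tsum_sub (s2 ν), t1 ν, t2 ν, ← Summable.tsum_sub]
      · exact tsum_congr fun u => by ring
      · exact summable_mul_of_bdd h0 (fun z => abs_pdiffAdjZ_le (bP2 ν) _ ν z)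
      · exact summable_mul_of_bdd h0 (fun z => abs_pdiffZ_le (bP3 ν) _ μ z)
    rw [Finset.sum_congr rfl fun ν _ => e4 ν]
    rw [← Summable.tsum_finsetSum (fun ν _ => summable_mul_of_bdd h0 (fun z =>
          (abs_sub _ _).trans (add_le_add (abs_pdiffAdjZ_le (bP2 ν) _ ν z) (abs_pdiffZ_le (bP3 ν) _ μ z))))]
    -- pointwise: Σ_ν [∂*_ν∂*_μ∂_νP − ∂_μ∂*_ν∂_νP] = ∂*_μN − ∂_μN
    have pw : ∀ u, ∑ ν : Fin d, C u * (pdiffAdjZ c ν (pdiffAdjZ c μ (pdiffZ c ν P)) u -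
        pdiffZ c μ (pdiffAdjZ c ν (pdiffZ c ν P)) u) = C u * (pdiffAdjZ c μ N u - pdiffZ c μ N u) := by
      intro u
      rw [← Finset.mul_sum, Finset.sum_sub_distrib]
      congr 2
      · rw [hN, hc]
        rw [show negLapZ ξ P = fun v => ∑ ν : Fin d, pdiffAdjZ ξ⁻¹ ν (pdiffZ ξ⁻¹ ν P) v from
          funext fun v => (sum_pdiffAdjZ_pdiffZ ξ P v).symm, pdiffAdjZ_finset_sum]
        exact Finset.sum_congr rfl fun ν _ => pdiffAdjZ_comm _ _ ν μ _ u
      · rw [hN, hc]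
        rw [show negLapZ ξ P = fun v => ∑ ν : Fin d, pdiffAdjZ ξ⁻¹ ν (pdiffZ ξ⁻¹ ν P) v from
          funext fun v => (sum_pdiffAdjZ_pdiffZ ξ P v).symm, pdiffZ_finset_sum]
    rw [tsum_congr pw]
    -- summation by parts back: Σ C·(∂*_μN − ∂_μN) = Σ (∂_μC − ∂*_μC)·N
    have u1 : ∑' u, C u * pdiffAdjZ c μ N u = ∑' u, pdiffZ c μ C u * N u := (tsum_pdiffZ_mul h0 hNb c μ).symm
    have u2 : ∑' u, C u * pdiffZ c μ N u = ∑' u, pdiffAdjZ c μ C u * N u := (tsum_pdiffAdjZ_mul h0 hNb c μ).symm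
    have sN1 : Summable fun u => C u * pdiffAdjZ c μ N u := summable_mul_of_bdd h0 fun z => abs_pdiffAdjZ_le hNb _ μ z
    have sN2 : Summable fun u => C u * pdiffZ c μ N u := summable_mul_of_bdd h0 fun z => abs_pdiffZ_le hNb _ μ z
    have sN3 : Summable fun u => pdiffZ c μ C u * N u := summable_mul_of_bdd (l1 μ) hNb
    have sN4 : Summable fun u => pdiffAdjZ c μ C u * N u := summable_mul_of_bdd l2 hNb
    calc ∑' u, C u * (pdiffAdjZ c μ N u - pdiffZ c μ N u)
        = ∑' u, (C u * pdiffAdjZ c μ N u - C u * pdiffZ c μ N u) := tsum_congr fun u => by ring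
      _ = ∑' u, pdiffZ c μ C u * N u - ∑' u, pdiffAdjZ c μ C u * N u := by rw [sN1.tsum_sub sN2, u1, u2]
      _ = ∑' u, (pdiffZ c μ C u - pdiffAdjZ c μ C u) * N u := by
          rw [← sN3.tsum_sub sN4]; exact tsum_congr fun u => by ring
  rw [hL, hM]

/-- **(3.38) FOR C^ξ BY THE PRINTED DIRECT ROUTE** (ξ > 0): first member = middle member by summation by parts in y and
Σ_ν∂^ξ_ν∂^{ξ*}_ν = −Δ^ξ (`lhs338_eq_mid338Of` at C = C^ξ, which is even and ℓ¹: `Cxi_neg`, `summable_abs_Cxi`) — independent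
of v1's `lhs338_eq_mid338`, which went through p03's first = last (`B3Eq324Parseval.eq338_holds`, convolution theorem on T^d).
[cite: Balaban1983Higgs3, (3.38) p.444] -/
theorem lhs338_eq_mid338_direct {ξ : ℝ} (hξ : 0 < ξ) (q3 : ℝ) (y' : ZSite d) (μ : Fin d) :
    lhs338 ξ q3 (Cxi d ξ) y' μ = mid338 d ξ q3 μ := by
  rw [mid338_eq_of]
  exact lhs338_eq_mid338Of ξ q3 (Cxi d ξ) (Cxi_neg ξ) (summable_abs_Cxi hξ) y' μ

/-- **The printed chain (3.38) for C^ξ, member by member along the printed route** (ξ > 0): first = middle (summation by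
parts, this section) and middle = last (−Δ^ξC^ξ = δ^ξ − C^ξ of (3.16), v1 `mid338_eq_last338`), the last member vanishing by
oddness (`last338_Cxi_eq_zero`) — hence a second, independent proof of r15's typed chain `B3Sect3TriangleGraphs.Eq338 d ξ q3`
(the first, p03 g2's `B3Eq324Parseval.eq338_holds`, used Parseval on T^d). [cite: Balaban1983Higgs3, (3.38) p.444] -/
theorem eq338_direct {ξ : ℝ} (hξ : 0 < ξ) (q3 : ℝ) : Eq338 d ξ q3 := fun y' μ => by
  rw [lhs338_eq_mid338_direct hξ, mid338_eq_last338 hξ]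

end DirectRoute

end Literature.MathematicalPhysics.QuantumFieldTheory.Balaban1983to89.B3Eq338Middle
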